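import Literature.Computability.AlgebraicComplexity.DeterminantalComplexity
import Mathlib.FieldTheory.IsAlgClosed.Basic
import Mathlib.Analysis.Complex.Polynomial.Basic
import HarnessLib

/-!
# Every ternary form is a symmetric linear determinant (Beauville 2000, §4, Remark; Dickson 1921)
# — named fact

Topic `Literature/Computability/AlgebraicComplexity` (it bounds the determinantal complexity of
ternary forms; consumer: crux `stmt-ValiantsHypothesis-12624`, Axis D3 of
`Cruxes/ValuativeFlip/DECOMPOSITIONS.md` — the three-variable restriction variety of `Δ(det_m)` is
all of `Sym^m ℂ³`; cite item wi-32803). NAMED FACT (D-0014) with proved corollaries: the `ℂ`-instance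
in the shape the crux consumes, the resulting AFFINE determinantal representation of size `d`
(`HasDetRepr f d`, hence `dc f ≤ d`), and a sanity instance (`x₀ᵈ = det(x₀·1_d)`).

## Source, verbatim

A. Beauville, *Determinantal hypersurfaces*, Michigan Math. J. 48 (2000) 39–64
(= arXiv:math/9910030, held; §4 "Plane curves", under the standing assumption "Assume now
`ch(k) = 0`" with the footnote "This works equally well in all characteristics `≠ 2`, but
references are lacking"), the Remark closing the subsection on theta-characteristics (after
Cor. 4.3 in the journal numbering): "If `k` is algebraically closed, any smooth plane curve admits
a theta-characteristic `L` with `H⁰(L) = 0` […] Thus every smooth plane curve can be defined by a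
symmetric linear determinant. Actually every plane curve `C` admits such a representation: one
reduces readily to the case when `C` is integral; then one applies Theorem B to the sheaf `π_*L`,
where `π : C' → C` is the normalization of `C` and `L` is a theta-characteristic on `C'` with
`H⁰(C', L) = 0`." (Theorem B, §2: an integral hypersurface of degree `d` with a torsion-free ACM
sheaf carrying a symmetric invertible form is defined by a symmetric determinant; for a plane
curve and such an `L`, a symmetric `d × d` matrix of LINEAR forms, cf. (4.2)/(4.3).) The general
(not necessarily symmetric) linear determinantal representation of an arbitrary ternary form is
classical: L. E. Dickson, Trans. AMS 22 (1921) 167–179.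

## Rendering

For `k` ALGEBRAICALLY CLOSED of CHARACTERISTIC ZERO, every `d ≥ 1` and every `f ∈ k[x₀, x₁, x₂]`
homogeneous of degree `d` (Mathlib `MvPolynomial.IsHomogeneous`; the zero polynomial, homogeneous of
every degree, is the determinant of the zero matrix), there are SYMMETRIC matrices
`A₀, A₁, A₂ ∈ Sym_d(k)` with `f = det(x₀ A₀ + x₁ A₁ + x₂ A₂)` EXACTLY (the source gives the
equation of the curve up to a unit `c`; over an algebraically closed field `c = λᵈ` and `λ` is
absorbed into the matrix, preserving symmetry; reducible and non-reduced forms: block-diagonal sums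
of representations of the integral factors, as in the printed reduction "to the case when `C` is
integral"). TODO(general form): characteristic `≠ 2` (Beauville's footnote).

## References

* [Beauville2000] A. Beauville, Determinantal hypersurfaces, Michigan Math. J. 48 (2000), §4
  Remark after Cor. 4.3, Theorem B (§2), (4.2)–(4.3).
* [Dickson1921] L. E. Dickson, Determination of all general homogeneous polynomials expressible as
  determinants with linear elements, Trans. Amer. Math. Soc. 22 (1921) 167–179.
* [MignonRessayre2004] (affine determinantal representations, `dc`; the tree's `HasDetRepr`).
-/

noncomputable section

open MvPolynomial

namespace Literature.Computability.AlgebraicComplexity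

universe u

/-- The `d × d` matrix of LINEAR forms `x₀ A₀ + x₁ A₁ + x₂ A₂` attached to three scalar matrices
`A 0, A 1, A 2` (entry `(i, j)`: `∑ₜ (A t)ᵢⱼ · xₜ`). [folklore] -/
def linearMatrix {k : Type u} [CommRing k] {d : ℕ} (A : Fin 3 → Matrix (Fin d) (Fin d) k) :
    Matrix (Fin d) (Fin d) (MvPolynomial (Fin 3) k) :=
  Matrix.of fun i j => ∑ t : Fin 3, A t i j • (X t : MvPolynomial (Fin 3) k)

/-- Unfolding of `linearMatrix`. [folklore] -/
theorem linearMatrix_apply {k : Type u} [CommRing k] {d : ℕ} (A : Fin 3 → Matrix (Fin d) (Fin d) k)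
    (i j : Fin d) : linearMatrix A i j = ∑ t : Fin 3, A t i j • (X t : MvPolynomial (Fin 3) k) :=
  rfl

/-- NAMED FACT — **every ternary form over an algebraically closed field of characteristic zero is
a symmetric linear determinant** (Beauville 2000, §4, Remark after Cor. 4.3: "every smooth plane
curve can be defined by a symmetric linear determinant. Actually every plane curve `C` admits such
a representation: one reduces readily to the case when `C` is integral; then one applies Theorem B
to the sheaf `π_*L` …"; Dickson 1921 for general linear determinants): for `k` algebraically
closed with `char k = 0`, `d ≥ 1` and `f ∈ k[x₀,x₁,x₂]` homogeneous of degree `d`, there are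
symmetric `A₀, A₁, A₂ ∈ Sym_d(k)` with `f = det(x₀A₀ + x₁A₁ + x₂A₂)` (rendering and the absorption
of the unit: module docstring). Users take `(h : Beauville2000_ternaryForm_symmDet.{u})`.
[cite: Beauville2000, §4 Remark after Cor. 4.3 (with Thm. B)] [cite: Dickson1921, main theorem] -/
def Beauville2000_ternaryForm_symmDet : Prop :=
  ∀ (k : Type u) [Field k] [IsAlgClosed k] [CharZero k] (d : ℕ), 1 ≤ d →
    ∀ f : MvPolynomial (Fin 3) k, f.IsHomogeneous d →
      ∃ A : Fin 3 → Matrix (Fin d) (Fin d) k, (∀ t, (A t).IsSymm) ∧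
        f = (Matrix.of fun i j => ∑ t : Fin 3, A t i j • (X t : MvPolynomial (Fin 3) k)).det

/-- **The `ℂ`-instance in the consumer's shape** (symmetry dropped): every ternary form of degree
`d ≥ 1` over `ℂ` is the determinant of a `d × d` matrix of linear forms.
[cite: Beauville2000, §4 Remark after Cor. 4.3] [cite: Dickson1921, main theorem] -/
theorem Beauville2000_ternaryForm_symmDet.complex (h : Beauville2000_ternaryForm_symmDet.{0}) :
    ∀ (d : ℕ), 1 ≤ d → ∀ f : MvPolynomial (Fin 3) ℂ, f.IsHomogeneous d →
      ∃ A : Fin 3 → Matrix (Fin d) (Fin d) ℂ,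
        f = (Matrix.of fun i j => ∑ t : Fin 3, A t i j • (X t : MvPolynomial (Fin 3) ℂ)).det := by
  intro d hd f hf
  obtain ⟨A, -, hA⟩ := h ℂ d hd f hf
  exact ⟨A, hA⟩

/-- The entries of a matrix of linear forms have total degree `≤ 1`. [folklore] -/
theorem totalDegree_linearMatrix_le {k : Type u} [CommRing k] {d : ℕ}
    (A : Fin 3 → Matrix (Fin d) (Fin d) k) (i j : Fin d) : (linearMatrix A i j).totalDegree ≤ 1 := by
  rw [linearMatrix_apply]
  refine (totalDegree_finsetSum _ _).trans (Finset.sup_le fun t _ => ?_)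
  refine (totalDegree_smul_le _ _).trans ?_
  by_cases hk : Nontrivial k
  · rw [totalDegree_X]
  · haveI := not_nontrivial_iff_subsingleton.mp hk
    rw [Subsingleton.elim (X t : MvPolynomial (Fin 3) k) 0, totalDegree_zero]
    exact zero_le_one

/-- **Consequence: an affine determinantal representation of size `d`** (the tree's `HasDetRepr`,
Mignon–Ressayre 2004 §1): under the fact, every ternary form of degree `d ≥ 1` over an
algebraically closed field of characteristic zero has `HasDetRepr f d` — a linear matrix is in
particular an affine one. [cite: Beauville2000, §4 Remark after Cor. 4.3]
[cite: MignonRessayre2004, §1] -/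
theorem Beauville2000_ternaryForm_symmDet.hasDetRepr (h : Beauville2000_ternaryForm_symmDet.{u})
    {k : Type u} [Field k] [IsAlgClosed k] [CharZero k] {d : ℕ} (hd : 1 ≤ d)
    (f : MvPolynomial (Fin 3) k) (hf : f.IsHomogeneous d) : HasDetRepr f d := by
  obtain ⟨A, -, hA⟩ := h k d hd f hf
  exact ⟨linearMatrix A, fun i j => totalDegree_linearMatrix_le A i j, hA.symm⟩

/-- **Hence `dc f ≤ d`** for ternary forms of degree `d ≥ 1` over an algebraically closed field of
characteristic zero (`determinantalComplexity` is the least size of an affine representation).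
[cite: Beauville2000, §4 Remark after Cor. 4.3] [cite: MignonRessayre2004, §1] -/
theorem Beauville2000_ternaryForm_symmDet.determinantalComplexity_le
    (h : Beauville2000_ternaryForm_symmDet.{u}) {k : Type u} [Field k] [IsAlgClosed k] [CharZero k]
    {d : ℕ} (hd : 1 ≤ d) (f : MvPolynomial (Fin 3) k) (hf : f.IsHomogeneous d) :
    determinantalComplexity f ≤ d :=
  Nat.sInf_le (h.hasDetRepr hd f hf)

/-- Sanity instance, proved outright: the form `x₀ᵈ` is the symmetric linear determinant
`det(x₀ · 1_d)` (`A₀ = 1`, `A₁ = A₂ = 0`). [folklore] -/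
theorem X_pow_eq_det_linearMatrix (k : Type u) [CommRing k] (d : ℕ) :
    (X 0 : MvPolynomial (Fin 3) k) ^ d =
      (linearMatrix (fun t : Fin 3 => if t = 0 then (1 : Matrix (Fin d) (Fin d) k) else 0)).det := by
  have hM : linearMatrix (fun t : Fin 3 => if t = 0 then (1 : Matrix (Fin d) (Fin d) k) else 0) =
      Matrix.diagonal fun _ : Fin d => (X 0 : MvPolynomial (Fin 3) k) := by
    ext i j
    rw [linearMatrix_apply, Fin.sum_univ_three]
    simp only [Fin.isValue, ↓reduceIte, one_ne_zero, Fin.reduceEq, Matrix.zero_apply, zero_smul,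
      add_zero, Matrix.diagonal_apply]
    by_cases hij : i = j
    · subst hij; simp
    · simp [Matrix.one_apply_ne hij, hij]
  rw [hM, Matrix.det_diagonal, Finset.prod_const, Finset.card_univ, Fintype.card_fin]

end Literature.Computability.AlgebraicComplexity

end
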